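import Summits.Ventures.LatticeQCDFlow.Scaling.ReplicaExchangeFiniteSampler
import Summits.Ventures.LatticeQCDFlow.Scaling.LadderPoincare
import Literature.Probability.MarkovChains.ProductChainSpectralGap
import Literature.Probability.MarkovChains.AsymptoticVarianceSpectral
import Literature.Probability.MarkovChains.NetworkReduction

/-!
HONEST FRAMING: exact (Metropolis-corrected) sampling algorithms for lattice gauge theory; figures
of merit are autocorrelation/cost numbers at stated couplings and volumes; no continuum-physics
claim.

# ReplicaExchangeFiniteGap — THE CEILING FOR REPLICA EXCHANGE UNDER IMPERFECT REPLICA UPDATES: ON A FINITE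
# CONFIGURATION SPACE `Gap ≥ min{2ta/(3K(K+1)²), a(1−t)γ_M/((K+1)(3(K+1)² + a))}` PER STEP (`a` ≤ adjacent swap
# acceptance rates, `γ_M` = Poincaré constant of the replica updates), HENCE `asympVar(g) ≤ (2/that − 1)·Var(g)`
# FOR EVERY OBSERVABLE OF (tag, replicas) (lean-2 GEN-16, ours)

Venture-side (OURS).  Cell `lqcd-flow` (pub-lqcd), unit `pub-lqcd-lean-2-g16`, 2026-08-24.  Continues
`Scaling/ReplicaExchangeFiniteSampler` (`P = ptFinSampler t μ M = t·Sw + (1−t)·U`, target `π = ptFinLaw μ`, block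
map = the tag).  Ingredients of the Jerrum–Son–Tetali–Vigoda decomposition (Literature, PROVED): (i) the
PROJECTION chain is the lazy acceptance ladder walk, Poincaré constant `2ta/(K(K+1)²)` (`Scaling/LadderPoincare`);
(ii) the RESTRICTION chains contain `(1−t)×` the product replica update, Poincaré constant `γ_M/(K+1)` by
TENSORISATION (Literature `ProductChainSpectralGap.prodKernel_poincare`, Levin–Peres–Wilmer Cor. 12.13);
(iii) the ESCAPE probability is `≤ 2t/K` (only the two pairs touching the tag move it) — the sharp count that
keeps the ceiling at the simulated-tempering order.  Proved: §0 `ptFin_escapeProb_le_sharp`;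
§1 `ptFin_projection_poincare`, `ptFin_restriction_poincare`; §2 `ptFinSampler_isIrreducible`; §3
**`ptFin_spectralGap_ge`: min{2ta/(3K(K+1)²), a(1−t)γ_M/((K+1)(3(K+1)²+a))} ≤ Gap(P)** (`a` ≤ adjacent
acceptance rates `ptFinAcc`, `γ_M` a uniform Poincaré constant of the replica updates, `0 < t < 1`, `K ≥ 1`) and
**`ptFin_asympVar_le`: asympVar g π P ≤ (2/c − 1)·Var_π(g) for EVERY observable** — `τ_int(g) ≤ 1/c − ½ =
O((K+1)³/(aγ_M))` STEPS = `O((K+1)²/(aγ_M))` in units of `K+1` single-replica updates, the simulated-tempering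
order; closed-form constants at `t = ½` in `Scaling/ReplicaExchangeFiniteCeiling`.

NOT CLAIMED: sharp constants; that the `1/γ_M` inflation is attained; general configuration spaces; half-sweep
schedules; anything measured.  Literature grade (cell rule): KNOWN MECHANISM (Madras–Randall 2002,
Woodard–Schmidler–Huber 2009, Jerrum–Son–Tetali–Vigoda 2004; Levin–Peres–Wilmer Cor. 12.13) with explicit
constants, NEW TYPING; nothing cited as a fact; no new bib keys.
-/

noncomputable section

open Finset Function
open Literature.Probability.MarkovChains
open Literature.Probability.MarkovChains.Decomposition

namespace Summit.Ventures.LatticeQCDFlow.Scaling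

variable {S : Type*} [Fintype S] [DecidableEq S] {K : ℕ} {μ : Fin (K + 1) → S → ℝ}
  {M : Fin (K + 1) → S → S → ℝ} {t : ℝ}

/-! ## §0 Escape probability `≤ 2t/K` -/

/-- Only the two pairs touching the tag can move it: `#{j : σ_jτ ≠ τ} ≤ 2`. [ours] -/
theorem card_filter_levelSwap_ne_le (τ : Fin (K + 1)) :
    (univ.filter fun j : Fin K => levelSwap j τ ≠ τ).card ≤ 2 := by
  calc (univ.filter fun j : Fin K => levelSwap j τ ≠ τ).card
      ≤ ({τ.val, τ.val - 1} : Finset ℕ).card := by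
        refine Finset.card_le_card_of_injOn (fun j : Fin K => (j : ℕ)) (fun j hj => ?_)
          (fun a _ b _ hab => Fin.ext hab)
        have hj' : levelSwap j τ ≠ τ := by simpa using hj
        simp only [Finset.coe_insert, Finset.coe_singleton, Set.mem_insert_iff, Set.mem_singleton_iff]
        unfold levelSwap at hj'
        by_contra hcon
        push Not at hcon
        apply hj'
        apply Equiv.swap_apply_of_ne_of_ne
        · intro h; apply hcon.1; simp [h]
        · intro h; apply hcon.2; simp [h]
    _ ≤ 2 := Finset.card_le_two

/-- **The ESCAPE probability of the tag is at most `2t/K`** (a swap attempt picks one of `K` pairs; at most two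
of them touch the tag; replica updates never move it). [ours] -/
theorem ptFin_escapeProb_le_sharp (hμ : ∀ k x, 0 < μ k x) (ht0 : 0 ≤ t) (p : Fin (K + 1) × (Fin (K + 1) → S)) :
    escapeProb (ptFinSampler t μ M) Prod.fst p ≤ 2 * t / K := by
  unfold escapeProb
  set F := univ.filter (fun q : Fin (K + 1) × (Fin (K + 1) → S) => q.1 ≠ p.1) with hF
  -- on `F` the sampler is `t·Sw ≤ t·T`
  have h1 : ∀ q ∈ F, ptFinSampler t μ M p q ≤ t * ptFinProposal p q := by
    intro q hq
    rw [hF, Finset.mem_filter] at hq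
    have hqp : q ≠ p := fun e => hq.2 (by rw [e])
    rw [ptFinSampler_apply, ptFinUpdate_apply, if_neg hq.2, mul_zero, add_zero]
    unfold ptFinSwap
    rw [mhKernel_of_ne hqp]
    exact mul_le_mul_of_nonneg_left (mhRate_le _ _ _ _) ht0
  refine (sum_le_sum h1).trans ?_
  rw [← Finset.mul_sum]
  unfold ptFinProposal
  rw [Finset.sum_comm]
  have h2 : ∀ j : Fin K, ∑ q ∈ F, (if q = swapAct j p then (1 : ℝ) / K else 0)
      = if levelSwap j p.1 ≠ p.1 then (1 : ℝ) / K else 0 := by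
    intro j
    rw [Finset.sum_ite_eq' F (swapAct j p)]
    refine if_congr ?_ rfl rfl
    rw [hF, Finset.mem_filter]
    exact ⟨fun h => h.2, fun h => ⟨mem_univ _, h⟩⟩
  simp_rw [h2]
  rw [← Finset.sum_filter, Finset.sum_const, nsmul_eq_mul]
  have hc : ((univ.filter fun j : Fin K => levelSwap j p.1 ≠ p.1).card : ℝ) ≤ 2 := by
    exact_mod_cast card_filter_levelSwap_ne_le p.1
  rcases Nat.eq_zero_or_pos K with hK | hK
  · subst hK; simp
  · calc t * (((univ.filter fun j : Fin K => levelSwap j p.1 ≠ p.1).card : ℝ) * (1 / K))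
        ≤ t * (2 * (1 / K)) := mul_le_mul_of_nonneg_left (mul_le_mul_of_nonneg_right hc (by positivity)) ht0
      _ = 2 * t / K := by ring

/-! ## §1 Poincaré constants of the projection chain and of the restriction chains -/

/-- Detailed balance makes the flow between blocks symmetric. [ours] -/
theorem blockFlow_symm_of_detailedBalance {X I : Type*} [Fintype X] {π : X → ℝ} {P : Matrix X X ℝ}
    (hDB : DetailedBalance π P) (blk : X → I) [DecidableEq I] (i j : I) :
    blockFlow π P blk i j = blockFlow π P blk j i := by
  unfold blockFlow
  rw [Finset.sum_comm]
  exact sum_congr rfl fun y _ => sum_congr rfl fun x _ => hDB x y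

/-- Termwise: the flow `π̄(τ)P̄(τ,τ')(g τ − g τ')²` dominates `(ta/(K(K+1)))·([τ' = τ+1] + [τ = τ'+1])·(g τ − g τ')²`
when `a ≤` every adjacent acceptance rate. [ours] -/
theorem ptFin_blockFlow_mul_sq_ge (hμ : ∀ k x, 0 < μ k x) (hM : ∀ k, IsRowStochastic (M k))
    (hMrev : ∀ k, DetailedBalance (μ k) (M k)) (ht0 : 0 ≤ t) (ht1 : t ≤ 1) {a : ℝ}
    (hacc : ∀ j : Fin K, a ≤ ptFinAcc μ j) (g : Fin (K + 1) → ℝ) (τ τ' : Fin (K + 1)) :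
    t * a / (K * (K + 1)) * ((if τ'.val = τ.val + 1 then (g τ - g τ') ^ 2 else 0)
        + (if τ.val = τ'.val + 1 then (g τ - g τ') ^ 2 else 0))
      ≤ blockFlow (ptFinLaw μ) (ptFinSampler t μ M) Prod.fst τ τ' * (g τ - g τ') ^ 2 := by
  have hflow : ∀ j : Fin K, t * a / (K * (K + 1))
      ≤ blockFlow (ptFinLaw μ) (ptFinSampler t μ M) Prod.fst j.castSucc j.succ := by
    intro j
    refine le_trans ?_ (ptFin_blockFlow_ge (M := M) hμ hM ht0 ht1 j)
    rw [mul_div_assoc, mul_div_assoc]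
    exact mul_le_mul_of_nonneg_left (div_le_div_of_nonneg_right (hacc j) (by positivity)) ht0
  have hF0 : 0 ≤ blockFlow (ptFinLaw μ) (ptFinSampler t μ M) Prod.fst τ τ' :=
    blockFlow_nonneg (fun p => (ptFinLaw_pos hμ p).le) (ptFinSampler_isRowStochastic hμ hM ht0 ht1).1 _ _ _
  by_cases h1 : τ'.val = τ.val + 1
  · have hj : τ.val < K := by have := τ'.2; omega
    set j : Fin K := ⟨τ.val, hj⟩ with hjdef
    have e1 : τ = j.castSucc := Fin.ext (by simp [hjdef])
    have e2 : τ' = j.succ := Fin.ext (by simp [hjdef]; omega)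
    rw [if_pos h1, if_neg (by omega), add_zero]
    refine mul_le_mul_of_nonneg_right ?_ (sq_nonneg _)
    rw [e1, e2]
    exact hflow j
  by_cases h2 : τ.val = τ'.val + 1
  · have hj : τ'.val < K := by have := τ.2; omega
    set j : Fin K := ⟨τ'.val, hj⟩ with hjdef
    have e1 : τ' = j.castSucc := Fin.ext (by simp [hjdef])
    have e2 : τ = j.succ := Fin.ext (by simp [hjdef]; omega)
    rw [if_neg h1, if_pos h2, zero_add]
    refine mul_le_mul_of_nonneg_right ?_ (sq_nonneg _)
    rw [blockFlow_symm_of_detailedBalance (ptFinSampler_detailedBalance hμ hMrev) Prod.fst, e1, e2]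
    exact hflow j
  · rw [if_neg h1, if_neg h2, add_zero, mul_zero]
    exact mul_nonneg hF0 (sq_nonneg _)

/-- **Poincaré inequality for the projection chain (the acceptance ladder walk):**
`(2ta/(K(K+1)²))·Var_π̄(g) ≤ 𝓔_π̄(P̄; g)` when `a ≤` every adjacent acceptance rate (`π̄` uniform). [ours] -/
theorem ptFin_projection_poincare (hμ : ∀ k x, 0 < μ k x) (hμ1 : ∀ k, ∑ x, μ k x = 1)
    (hM : ∀ k, IsRowStochastic (M k)) (hMrev : ∀ k, DetailedBalance (μ k) (M k)) (ht0 : 0 ≤ t) (ht1 : t ≤ 1)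
    {a : ℝ} (ha0 : 0 ≤ a) (hacc : ∀ j : Fin K, a ≤ ptFinAcc μ j) (g : Fin (K + 1) → ℝ) :
    2 * t * a / (K * (K + 1) ^ 2) * lawVariance (blockMass (ptFinLaw μ) Prod.fst) g
      ≤ dirichletForm (blockMass (ptFinLaw μ) Prod.fst)
          (projectionChain (ptFinLaw μ) (ptFinSampler t μ M) Prod.fst) g := by
  have hMass : ∀ i, blockMass (ptFinLaw μ) Prod.fst i ≠ 0 := fun i => by rw [ptFin_blockMass hμ1]; positivity
  have hunif : blockMass (ptFinLaw μ) (Prod.fst : Fin (K + 1) × (Fin (K + 1) → S) → Fin (K + 1))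
      = fun _ => (1 : ℝ) / (K + 1) := funext fun i => ptFin_blockMass hμ1 i
  -- the Dirichlet form dominates `(ta/(K(K+1)))·Σ_k (g(k+1) − g k)²`
  have hE : t * a / (K * (K + 1)) * ∑ k : Fin K, (g k.succ - g k.castSucc) ^ 2
      ≤ dirichletForm (blockMass (ptFinLaw μ) Prod.fst)
          (projectionChain (ptFinLaw μ) (ptFinSampler t μ M) Prod.fst) g := by
    unfold dirichletForm
    simp_rw [blockMass_mul_projectionChain (hMass _)]
    have hsum := Finset.sum_le_sum fun τ (_ : τ ∈ (univ : Finset (Fin (K + 1)))) =>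
      Finset.sum_le_sum fun τ' (_ : τ' ∈ (univ : Finset (Fin (K + 1)))) =>
        ptFin_blockFlow_mul_sq_ge hμ hM hMrev ht0 ht1 hacc g τ τ'
    have hL : ∑ τ : Fin (K + 1), ∑ τ' : Fin (K + 1), t * a / (K * (K + 1))
        * ((if τ'.val = τ.val + 1 then (g τ - g τ') ^ 2 else 0) + (if τ.val = τ'.val + 1 then (g τ - g τ') ^ 2 else 0))
        = t * a / (K * (K + 1)) * (2 * ∑ k : Fin K, (g k.succ - g k.castSucc) ^ 2) := by
      simp_rw [← Finset.mul_sum, Finset.sum_add_distrib]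
      rw [sum_sum_ite_val_succ (fun i j => (g i - g j) ^ 2), sum_sum_ite_val_pred (fun i j => (g i - g j) ^ 2)]
      congr 1
      rw [two_mul]
      congr 1
      exact sum_congr rfl fun k _ => by ring
    rw [hL] at hsum
    have e : t * a / (K * (K + 1)) * ∑ k : Fin K, (g k.succ - g k.castSucc) ^ 2
        = 1 / 2 * (t * a / (K * (K + 1)) * (2 * ∑ k : Fin K, (g k.succ - g k.castSucc) ^ 2)) := by ring
    rw [e]
    exact mul_le_mul_of_nonneg_left hsum (by norm_num)
  have hvar := lawVariance_uniform_le_ladder K g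
  rw [← hunif] at hvar
  refine le_trans ?_ hE
  rcases Nat.eq_zero_or_pos K with hK | hK
  · subst hK; simp
  calc 2 * t * a / (K * (K + 1) ^ 2) * lawVariance (blockMass (ptFinLaw μ) Prod.fst) g
      ≤ 2 * t * a / (K * (K + 1) ^ 2) * (((K + 1 : ℝ) / 2) * ∑ k : Fin K, (g k.succ - g k.castSucc) ^ 2) :=
        mul_le_mul_of_nonneg_left hvar (by positivity)
    _ = t * a / (K * (K + 1)) * ∑ k : Fin K, (g k.succ - g k.castSucc) ^ 2 := by
        have hK' : (K : ℝ) ≠ 0 := by exact_mod_cast hK.ne'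
        field_simp

/-- **Poincaré inequality for the restriction chains:** a uniform Poincaré constant `γ_M` of the replica updates
gives, by tensorisation over the `K+1` replicas (each chosen with probability `1/(K+1)`),
`((1−t)γ_M/(K+1))·Var_{π_τ}(f) ≤ 𝓔_{π_τ}(P_τ; f)` on every tag block. [ours] -/
theorem ptFin_restriction_poincare (hμ : ∀ k x, 0 < μ k x) (hμ1 : ∀ k, ∑ x, μ k x = 1)
    (hM : ∀ k, IsRowStochastic (M k)) (ht0 : 0 ≤ t) (ht1 : t ≤ 1) {γ : ℝ}
    (hgap : ∀ k, ∀ h : S → ℝ, γ * lawVariance (μ k) h ≤ dirichletForm (μ k) (M k) h)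
    (τ : Fin (K + 1)) (f : Fin (K + 1) × (Fin (K + 1) → S) → ℝ) :
    (1 - t) * (γ / (K + 1)) * lawVariance (blockLaw (ptFinLaw μ) Prod.fst τ) f
      ≤ dirichletForm (blockLaw (ptFinLaw μ) Prod.fst τ) (restrictionChain (ptFinSampler t μ M) Prod.fst) f := by
  rw [ptFin_lawVariance_blockLaw hμ1, mul_assoc]
  refine le_trans (mul_le_mul_of_nonneg_left ?_ (by linarith))
    (ptFin_dirichletForm_restriction_ge (M := M) hμ hμ1 ht0 τ f)
  exact prodKernel_poincare (K + 1) (X := fun _ : Fin (K + 1) => S) (π := μ) (P := M)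
    (w := fun _ : Fin (K + 1) => (1 : ℝ) / (K + 1)) (γ := fun _ => γ) (c := γ / (K + 1))
    (fun k u => (hμ k u).le) hμ1 (fun k => (hM k).1) (fun _ => by positivity)
    (fun _ => by rw [one_div_mul_eq_div]) hgap (fun x => f (τ, x))

/-! ## §2 Irreducibility -/

/-- **The sampler is irreducible when every replica update is** (`0 < t < 1`, positive level laws): within a tag
block the product update reaches every replica configuration coordinate by coordinate, and the Metropolis swap
of the pair touching the tag has positive probability. [ours] -/
theorem ptFinSampler_isIrreducible (hμ : ∀ k x, 0 < μ k x) (hM : ∀ k, IsRowStochastic (M k))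
    (hMirr : ∀ k, IsIrreducible (M k)) (ht0 : 0 < t) (ht1 : t < 1) :
    IsIrreducible (ptFinSampler t μ M) := by
  have hP0 := (ptFinSampler_isRowStochastic hμ hM ht0.le ht1.le).1
  have hSw0 := (ptFinSwap_isRowStochastic hμ).1
  refine isIrreducible_of_forall_closed hP0 fun T hT hcl => ?_
  -- (A) one coordinate move inside a block
  have moveA : ∀ (τ : Fin (K + 1)) (x : Fin (K + 1) → S) (k : Fin (K + 1)) (v : S),
      (τ, x) ∈ T → 0 < M k (x k) v → (τ, update x k v) ∈ T := by
    intro τ x k v hx hv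
    refine hcl (τ, x) hx (τ, update x k v) ?_
    rw [ptFinSampler_apply, ptFinUpdate_apply, if_pos rfl, prodKernel_apply]
    have hk : (1 : ℝ) / (K + 1) * coordKernel M k x (update x k v)
        ≤ ∑ j, (1 : ℝ) / (K + 1) * coordKernel M j x (update x k v) :=
      Finset.single_le_sum (f := fun j => (1 : ℝ) / (K + 1) * coordKernel M j x (update x k v))
        (fun j _ => mul_nonneg (by positivity) (coordKernel_nonneg M (fun j => (hM j).1) j _ _)) (mem_univ k)
    have hck : coordKernel M k x (update x k v) = M k (x k) v := by
      unfold coordKernel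
      rw [update_self, if_pos rfl]
    rw [hck] at hk
    have : 0 < (1 - t) * ((1 : ℝ) / (K + 1) * M k (x k) v) := mul_pos (by linarith) (by positivity)
    nlinarith [mul_nonneg ht0.le (hSw0 (τ, x) (τ, update x k v))]
  -- (B) a whole coordinate
  have moveB : ∀ (τ : Fin (K + 1)) (x : Fin (K + 1) → S) (k : Fin (K + 1)),
      (τ, x) ∈ T → ∀ v, (τ, update x k v) ∈ T := by
    intro τ x k hx v
    set V : Finset S := univ.filter fun u => (τ, update x k u) ∈ T with hV
    have hxk : x k ∈ V := by rw [hV, Finset.mem_filter, update_eq_self]; exact ⟨mem_univ _, hx⟩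
    have hclV : ∀ u ∈ V, ∀ u', 0 < M k u u' → u' ∈ V := by
      intro u hu u' huu'
      rw [hV, Finset.mem_filter] at hu ⊢
      refine ⟨mem_univ _, ?_⟩
      have := moveA τ (update x k u) k u' hu.2 (by rwa [update_self])
      rwa [update_idem] at this
    have hVu := (hMirr k).eq_univ_of_closed (hM k).1 ⟨x k, hxk⟩ hclV
    have hv : v ∈ V := by rw [hVu]; exact mem_univ _
    rw [hV, Finset.mem_filter] at hv
    exact hv.2
  -- (C) a whole block
  have full : ∀ τ : Fin (K + 1), (∃ x, (τ, x) ∈ T) → ∀ y, (τ, y) ∈ T := by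
    intro τ ⟨x, hx⟩ y
    have key : ∀ s : Finset (Fin (K + 1)), (τ, s.piecewise y x) ∈ T := by
      intro s
      induction s using Finset.induction_on with
      | empty => rwa [Finset.piecewise_empty]
      | insert k s hk ih =>
        rw [Finset.piecewise_insert]
        exact moveB τ _ k ih _
    have := key univ
    rwa [Finset.piecewise_univ] at this
  -- (D) the swap touching the tag has positive probability
  have swapPos : ∀ (j : Fin K) (p : Fin (K + 1) × (Fin (K + 1) → S)), p ∈ T → swapAct j p ∈ T := by
    intro j p hp
    by_cases hq : swapAct j p = p
    · rwa [hq]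
    refine hcl p hp _ ?_
    have hflow := ptFinLaw_mul_ptFinSwap hμ hq
    have hpos : 0 < ptFinLaw μ p * ptFinSwap μ p (swapAct j p) := by
      rw [hflow]
      rcases Nat.eq_zero_or_pos K with hK | hK
      · exact absurd j.2 (by omega)
      exact mul_pos (lt_of_lt_of_le (by positivity) (ptFinProposal_swapAct_ge j p))
        (lt_min (ptFinLaw_pos hμ _) (ptFinLaw_pos hμ _))
    have hSw : 0 < ptFinSwap μ p (swapAct j p) := (mul_pos_iff_of_pos_left (ptFinLaw_pos hμ _)).mp hpos
    rw [ptFinSampler_apply]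
    nlinarith [mul_pos ht0 hSw, (ptFinUpdate_isRowStochastic hM).1 p (swapAct j p)]
  have stepUp : ∀ j : Fin K, (∀ y, (j.castSucc, y) ∈ T) → ∀ y, (j.succ, y) ∈ T := by
    intro j hj y
    refine full j.succ ⟨y ∘ levelSwap j, ?_⟩ y
    have := swapPos j (j.castSucc, y) (hj y)
    unfold swapAct at this
    rwa [levelSwap_castSucc] at this
  have stepDown : ∀ j : Fin K, (∀ y, (j.succ, y) ∈ T) → ∀ y, (j.castSucc, y) ∈ T := by
    intro j hj y
    refine full j.castSucc ⟨y ∘ levelSwap j, ?_⟩ y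
    have := swapPos j (j.succ, y) (hj y)
    unfold swapAct at this
    have e : levelSwap j j.succ = j.castSucc := by unfold levelSwap; exact Equiv.swap_apply_right _ _
    rwa [e] at this
  obtain ⟨⟨τ₀, x₀⟩, h0⟩ := hT
  have hτ₀ : ∀ y, (τ₀, y) ∈ T := full τ₀ ⟨x₀, h0⟩
  have up : ∀ d : ℕ, ∀ h : τ₀.val + d < K + 1, ∀ y, ((⟨τ₀.val + d, h⟩ : Fin (K + 1)), y) ∈ T := by
    intro d
    induction d with
    | zero => intro h y; exact hτ₀ y
    | succ d ih =>
      intro h y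
      have := stepUp ⟨τ₀.val + d, by omega⟩ (fun y => ih (by omega) y) y
      exact this
  have down : ∀ d : ℕ, ∀ h : d ≤ τ₀.val, ∀ y, ((⟨τ₀.val - d, by omega⟩ : Fin (K + 1)), y) ∈ T := by
    intro d
    induction d with
    | zero => intro h y; exact hτ₀ y
    | succ d ih =>
      intro h y
      have := stepDown ⟨τ₀.val - (d + 1), by omega⟩ (fun y => by
        have h' := ih (by omega) y
        have e : (⟨τ₀.val - (d + 1), by omega⟩ : Fin K).succ = ⟨τ₀.val - d, by omega⟩ := Fin.ext (by simp; omega)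
        rw [e]; exact h') y
      exact this
  refine Finset.eq_univ_of_forall fun p => ?_
  obtain ⟨τ, y⟩ := p
  by_cases h : τ₀.val ≤ τ.val
  · have e : τ = ⟨τ₀.val + (τ.val - τ₀.val), by omega⟩ := Fin.ext (by simp; omega)
    rw [e]; exact up _ _ y
  · have e : τ = ⟨τ₀.val - (τ₀.val - τ.val), by omega⟩ := Fin.ext (by simp; omega)
    rw [e]; exact down _ (by omega) y

/-! ## §3 The spectral gap and the asymptotic-variance ceiling -/

/-- **THE SPECTRAL GAP OF REPLICA EXCHANGE UNDER IMPERFECT REPLICA UPDATES** (Jerrum–Son–Tetali–Vigoda Theorem 1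
with the tag as block map): `a ≤` adjacent acceptance rates, `γ_M` a uniform Poincaré constant of the replica
updates, `0 < t < 1`, `K ≥ 1` ⇒
`min{2ta/(3K(K+1)²), a(1−t)γ_M/((K+1)(3(K+1)² + a))} ≤ Gap(ptFinSampler t μ M)` per step. [ours] -/
theorem ptFin_spectralGap_ge (hK : 1 ≤ K) (hμ : ∀ k x, 0 < μ k x) (hμ1 : ∀ k, ∑ x, μ k x = 1)
    (hM : ∀ k, IsRowStochastic (M k)) (hMrev : ∀ k, DetailedBalance (μ k) (M k))
    (ht0 : 0 < t) (ht1 : t < 1) {a γ : ℝ} (ha : 0 < a) (hγ : 0 < γ)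
    (hacc : ∀ j : Fin K, a ≤ ptFinAcc μ j)
    (hgap : ∀ k, ∀ h : S → ℝ, γ * lawVariance (μ k) h ≤ dirichletForm (μ k) (M k) h) :
    min (2 * t * a / (3 * K * (K + 1) ^ 2)) (a * (1 - t) * γ / ((K + 1) * (3 * (K + 1) ^ 2 + a)))
      ≤ spectralGap (ptFinLaw μ) (ptFinSampler t μ M) := by
  haveI : Nonempty S := by
    by_contra h
    rw [not_nonempty_iff] at h
    have := hμ1 0
    rw [Finset.univ_eq_empty, Finset.sum_empty] at this
    exact zero_ne_one this
  haveI : Nontrivial (Fin (K + 1)) := Fin.nontrivial_iff_two_le.mpr (by omega)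
  have hsurj : Function.Surjective (Prod.fst : Fin (K + 1) × (Fin (K + 1) → S) → Fin (K + 1)) :=
    Prod.fst_surjective
  have hKpos : (0 : ℝ) < K := by exact_mod_cast hK
  have hlamP : 0 < 2 * t * a / (K * (K + 1) ^ 2) := by positivity
  have hlamMin : 0 < (1 - t) * (γ / (K + 1)) := mul_pos (by linarith) (by positivity)
  have key := JerrumEtAl2004_thm_1_spectralGap (ptFinLaw_pos hμ) (sum_ptFinLaw hμ1)
    (ptFinSampler_isRowStochastic hμ hM ht0.le ht1.le) (ptFinSampler_detailedBalance hμ hMrev) hsurj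
    hlamP hlamMin (by positivity : (0 : ℝ) ≤ 2 * t / K)
    (ptFin_projection_poincare (M := M) hμ hμ1 hM hMrev ht0.le ht1.le ha.le hacc)
    (ptFin_restriction_poincare hμ hμ1 hM ht0.le ht1.le hgap)
    (ptFin_escapeProb_le_sharp (M := M) hμ ht0.le)
  refine le_trans (le_of_eq ?_) key
  have h1 : (K + 1 : ℝ) ≠ 0 := by positivity
  have h4 : ((K + 1) * (3 * (K + 1) ^ 2 + a) : ℝ) ≠ 0 := by positivity
  congr 1
  · field_simp
  · rw [div_eq_div_iff h4 (by positivity)]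
    field_simp

/-- **THE CEILING: the asymptotic variance of EVERY observable of the replica-exchange sampler** is at most
`(2/c − 1)·Var_π(g)` with `c` the gap bound above (irreducible replica updates). [ours] -/
theorem ptFin_asympVar_le (hK : 1 ≤ K) (hμ : ∀ k x, 0 < μ k x) (hμ1 : ∀ k, ∑ x, μ k x = 1)
    (hM : ∀ k, IsRowStochastic (M k)) (hMrev : ∀ k, DetailedBalance (μ k) (M k))
    (hMirr : ∀ k, IsIrreducible (M k)) (ht0 : 0 < t) (ht1 : t < 1) {a γ : ℝ} (ha : 0 < a) (hγ : 0 < γ)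
    (hacc : ∀ j : Fin K, a ≤ ptFinAcc μ j)
    (hgap : ∀ k, ∀ h : S → ℝ, γ * lawVariance (μ k) h ≤ dirichletForm (μ k) (M k) h)
    (g : Fin (K + 1) × (Fin (K + 1) → S) → ℝ) :
    asympVar g (ptFinLaw μ) (ptFinSampler t μ M)
      ≤ (2 / min (2 * t * a / (3 * K * (K + 1) ^ 2)) (a * (1 - t) * γ / ((K + 1) * (3 * (K + 1) ^ 2 + a))) - 1)
          * lawVariance (ptFinLaw μ) g := by
  haveI : Nonempty S := by
    by_contra h
    rw [not_nonempty_iff] at h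
    have := hμ1 0
    rw [Finset.univ_eq_empty, Finset.sum_empty] at this
    exact zero_ne_one this
  haveI : Nontrivial (Fin (K + 1)) := Fin.nontrivial_iff_two_le.mpr (by omega)
  have hKpos : (0 : ℝ) < K := by exact_mod_cast hK
  have h1 := asympVar_le_spectralGap (ptFinLaw_pos hμ) (sum_ptFinLaw hμ1)
    (ptFinSampler_isRowStochastic hμ hM ht0.le ht1.le) (ptFinSampler_detailedBalance (t := t) hμ hMrev)
    (ptFinSampler_isIrreducible hμ hM hMirr ht0 ht1) g
  have hc := ptFin_spectralGap_ge hK hμ hμ1 hM hMrev ht0 ht1 ha hγ hacc hgap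
  have hcpos : 0 < min (2 * t * a / (3 * K * (K + 1) ^ 2)) (a * (1 - t) * γ / ((K + 1) * (3 * (K + 1) ^ 2 + a))) :=
    lt_min (by positivity) (by apply div_pos (mul_pos (mul_pos ha (by linarith)) hγ); positivity)
  refine h1.trans (mul_le_mul_of_nonneg_right ?_ (lawVariance_nonneg (fun p => (ptFinLaw_pos hμ p).le) g))
  have := div_le_div_of_nonneg_left (by norm_num : (0 : ℝ) ≤ 2) hcpos hc
  linarith

end Summit.Ventures.LatticeQCDFlow.Scaling

end
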